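import Summits.HodgeConjecture.HodgeConjecture.Theses.HeckePrymWeil
import Summits.HodgeConjecture.HodgeConjecture.Theorems.HeckePrymWeilHeckePrymAnchorsOfStubs
import Summits.HodgeConjecture.HodgeConjecture.Theorems.HeckePrymWeilHeckePrymAnchorsUpgrade
import Summits.HodgeConjecture.HodgeConjecture.Theorems.HeckePrymWeilHeckePrymAnchorsRationalAlongSection
import Summits.HodgeConjecture.HodgeConjecture.Theorems.HeckePrymWeilHeckePrymAnchorsGlobalClassOfSection
import Literature.AlgebraicGeometry.HodgeTheory.WeilFamilyFlatSections
import Literature.AlgebraicGeometry.HodgeTheory.SemiregularVariationalHodge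
import Literature.AlgebraicGeometry.HodgeTheory.SemiregularityHigherSigma
import Literature.AlgebraicGeometry.HodgeTheory.StandardChernCharacterBetti
import Literature.AlgebraicGeometry.HodgeTheory.ComplexConjugationHolds
import Literature.AlgebraicGeometry.HodgeTheory.AbelJacobiPullbackHodgeSection
import Literature.AlgebraicGeometry.HodgeTheory.HodgeTypeConjugation
import Literature.AlgebraicGeometry.HodgeTheory.GysinFormalismHodgeOfGysin
import Literature.AlgebraicGeometry.Motives.VarietiesGeometricallyIntegralProofs
import HarnessLib

/-!
# `WeilTenfoldsSqrtMinus11` by the Perry route, FULL-SEMIREGULARITY FORM (item stmt-HodgeConjecture-1262, route HeckePrymWeil)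

Line `quaternionic-norm-anchors` of crux `HeckePrymWeil.WeilTenfoldsSqrtMinus11` (Hodge–Weil classes of every
complex abelian TENFOLD `A` with `φ ≫ φ = -11`, `K = ℚ(√-11)`, type `(5,5)`, are algebraic), skeleton v2.1
(lead c2, 2026-08-16, stub `stub_perryRouteCompositionFull`): the same composition as the landed
`Theorems/HeckePrymWeilWeilTenfoldsSqrtMinus11TensorAnchorPerry` (`stub_perryRouteComposition`, p116927),
with ONE CHANGE OF TYPING, made possible by `Literature/AlgebraicGeometry/HodgeTheory/SemiregularityHigherSigma`
(which constructs every component `σ_q = Tr(· ∘ At^q) : Ext²(E,E) → H^{q+2}(X, Ω^q)` and the notion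
`IsISemiregular hE I`): the semiregularity asked of the anchor object, and assumed in Perry's theorem, is the
SOURCE'S notion — injectivity of the WHOLE Buchweitz–Flenner map, `IsISemiregular hE₀ Set.univ`
([Perry2026Semiregularity, Def. 2.4, Rem. 2.5]; [BuchweitzFlenner2003, Def. 4.1, §5]) — instead of the
`{0,1}`-part `IsZeroOneSemiregular hE₀` that the tree could state when the line was planned.

WHY THIS MATTERS (lead c2 evidence `Cruxes/WeilTenfoldsSqrtMinus11/TensorAnchorDesign.md`): for a DIRECT SUM
of `T` line bundles on an abelian `g`-fold the diagonal part of the semiregularity map is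
`(x_t) ↦ (Σ_t c₁(L_t)^q ∪ x_t)_q` on `(H^{0,2})^T`, so `{0,1}`-semiregularity forces
`T ≤ (h^{0,2} + h^{1,3})/h^{0,2}` (`= 27` for `g = 10`), whereas full semiregularity only forces
`T ≤ Σ_q h^{q,q+2}/h^{0,2}` (`= 2799`); the Weil-pure designs found at the CM anchor need hundreds of
constituents. The full form is the WEAKER requirement on the object (the more plausible bet) and the STRONGER
— and printed — form of Perry's theorem; a `{0,1}`-semiregular sheaf is semiregular
(`Literature …SemiregularVariationalHodgeFull.isISemiregular_univ_of_isZeroOneSemiregular`, proposed p129195).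

Hypotheses of `stub_perryRouteCompositionFull` (CONDITIONAL result; nothing is asserted):
1. `HodgeTheory.deligne1982_weilFamily_hodgeWeilSection` (named fact, by name), at `(p, k) = (11, 5)`;
2. Perry 2026 Thm. 1.1 (2) with FULL semiregularity — spelled out verbatim (it is the statement
   `Perry2026_semiregularFull_remainsAlgebraic` of the Literature proposal p129195; this file does not wait
   for it and introduces no definition);
3. `Nonempty HodgeTheory.StandardChernCharacterBetti` (construction debt);
4. THE BET, full form (`stub_tensorAnchorObjectFull` of skeleton v2.1): on every `ℂ`-scheme `F₀ ≅ Y`,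
   `(Y, Ψ)` a `√-11` abelian tenfold with an isogeny pair towards a tensor point `(A₁ × A₁, companion)`, and
   for every non-zero rational `(5,5)` class `x₀` of `F₀` in the strong Weil plane, a finite locally free
   SEMIREGULAR (`IsISemiregular hE₀ Set.univ`) `E₀` with Weil-pure `ch(E₀) = r₀·1 + r·x₀`, `r ∈ ℚˣ`.

Contents: `sectionTransport_of_perryFull` (the engine step in section form, proved from hypothesis 2) and
`stub_perryRouteCompositionFull` (hypotheses 1–4 ⇒ the crux BY NAME); proofs verbatim those of the `{0,1}`
file. Private copies `tapf_sectionSmul` (= landed `HeckePrymWeil.TensorAnchor.stub_sectionSmul`) and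
`tapf_clsAt_rational_hodge` keep the file independent of other modules' build state.
-/

noncomputable section

-- single-problem summit (Problem = Summit): the mandated namespace repeats `HodgeConjecture`.
set_option linter.dupNamespace false

open CategoryTheory AlgebraicGeometry Limits MonoidalCategory CartesianMonoidalCategory
open Literature.AlgebraicGeometry Literature.AlgebraicGeometry.Motives
  Literature.AlgebraicGeometry.HodgeTheory
open Literature.AlgebraicTopology.SingularHomology
open Summit.HodgeConjecture.HodgeConjecture.Theorems.HeckePrymWeilLine
  (stub_upgrade stub_rationalAlongSection gcs_section_eq_of_eq owf_isoTransport owf_anchorAlgebraic)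

namespace Summit.HodgeConjecture.HodgeConjecture.Theorems.WeilTenfoldsSqrtMinus11.TensorAnchorPerryFull

/-! ## Infrastructure: scalar multiples of continuous sections of the étalé space (private copy) -/

/-- Fibrewise scalar multiples of continuous sections of the étalé space `FiberClass f k → S(ℂ)` of
`Rᵏ f_* ℂ` are continuous: the fibrewise map `(t, α) ↦ (t, r·α)` is continuous for the final topology
`FiberClass.instTopologicalSpace` because it carries the local section of a tube class `ξ` to the local
section of `r·ξ` (`fiberRestrict` is linear). Private copy of the line's landed
`HeckePrymWeil.TensorAnchor.stub_sectionSmul`. [cite: Hartshorne1977, II Ex. 1.13] -/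
private theorem tapf_sectionSmul {𝒳 S : SchemeOver ℂ} (f : 𝒳 ⟶ S) (k : ℕ) (r : ℂ)
    (σ : ComplexPoints S → FiberClass f k) (hpt : ∀ s, (σ s).pt = s) (hσ : Continuous σ) :
    Continuous fun s => (⟨s, r • (σ s).clsAt (hpt s)⟩ : FiberClass f k) := by
  -- the fibrewise scalar multiplication on the étalé space
  let sm : FiberClass f k → FiberClass f k := fun x => ⟨x.pt, r • x.cls⟩
  have hsm : Continuous sm := by
    refine continuous_iSup_dom.2 fun U => continuous_iSup_dom.2 fun ξ => continuous_coinduced_dom.2 ?_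
    have heq : sm ∘ tubeSection f k (U : Set (ComplexPoints S)) ξ =
        tubeSection f k (U : Set (ComplexPoints S)) (r • ξ) := by
      funext t
      show (⟨(t : ComplexPoints S), r • fiberRestrict f t.2 k ξ⟩ : FiberClass f k) =
        ⟨(t : ComplexPoints S), fiberRestrict f t.2 k (r • ξ)⟩
      rw [map_smul]
    rw [heq]
    exact continuous_tubeSection f k U (r • ξ)
  have key : ∀ (x : FiberClass f k) (s : ComplexPoints S) (h : x.pt = s),
      (⟨s, r • x.clsAt h⟩ : FiberClass f k) = sm x := by
    rintro ⟨_, _⟩ s h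
    cases h
    rfl
  have heq : (fun s => (⟨s, r • (σ s).clsAt (hpt s)⟩ : FiberClass f k)) = sm ∘ σ :=
    funext fun s => key (σ s) s (hpt s)
  rw [heq]
  exact hsm.comp hσ

/-- Transport of rationality and Hodge type of a fibre class across an equality of base points
(`FiberClass.clsAt` is transport along `x.pt = s`). [folklore] -/
private theorem tapf_clsAt_rational_hodge {𝒳 S : SchemeOver ℂ} {f : 𝒳 ⟶ S} {n k p : ℕ}
    (x : FiberClass f k) (s : ComplexPoints S) (h : x.pt = s) (hr : IsRationalClass x.cls)
    (hh : IsOfHodgeType n (fiberOver f x.pt) k p p x.cls) :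
    IsRationalClass (x.clsAt h) ∧ IsOfHodgeType n (fiberOver f s) k p p (x.clsAt h) := by
  obtain ⟨_, _⟩ := x
  cases h
  exact ⟨hr, hh⟩

/-! ## The engine step in section form: Weil transport from a Weil-pure SEMIREGULAR object (full BF map) -/

/-- **Section-form Weil transport from a Weil-pure semiregular object — FULL Buchweitz–Flenner map**
(Perry's theorem with the source's semiregularity, hypothesis `hP`, spelled out). Along a smooth projective family `f : 𝒳 ⟶ S` of relative dimension `10` over a smooth
irreducible quasi-projective base, let `σ` be a continuous section of `FiberClass f 10` with rational
`(5,5)` values. If at ONE point `s₀` there is a finite locally free SEMIREGULAR (`IsISemiregular hE₀ Set.univ`) `E₀` on the fibre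
with `ch₀(E₀) = r₀·1`, `chₖ(E₀) = 0` (`k ≠ 0, 5`) and `ch₅(E₀) = r·σ(s₀)` in some Chern character theory
`C`, then `r·σ(s)` is ALGEBRAIC on `X_s` for EVERY `s`: Perry's theorem applied to the Weil-pure family of
sections `(r₀·1, 0, 0, 0, 0, r·σ, 0, …)` — continuous (global sections of `r₀·1` and of `0`, and scalar
multiples of `σ`), valued in the locus of Hodge classes (degree-`0` classes are `(0,0)`, `0` is `(k,k)`,
`σ` is rational `(5,5)`), equal to `ch(E₀)` at `s₀`. The base is integral, being smooth (hence reduced)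
and irreducible. [cite: Perry2026Semiregularity, Thm. 1.1 (2)] [cite: BuchweitzFlenner2003, Thm. 5.1] -/
theorem sectionTransport_of_perryFull
    (hP : (∀ (C : ChernCharacterBetti) ⦃𝒳 S : SchemeOver ℂ⦄ (π : 𝒳 ⟶ S) (n : ℕ), IsSmoothProjectiveFamily π n → IsQuasiProjectiveOver S → AlgebraicGeometry.IsIntegral S.left → AlgebraicGeometry.Smooth S.hom → ∀ (w : ∀ (k : ℕ) (s : ComplexPoints S), complexBetti (fiberOver π s) (2 * k)), (∀ k, Continuous fun s => (⟨s, w k s⟩ : FiberClass π (2 * k))) → (∀ k s, (⟨s, w k s⟩ : FiberClass π (2 * k)) ∈ locusOfHodgeClasses π n k) → ∀ (s₀ : ComplexPoints S) (E₀ : (fiberOver π s₀).left.Modules) (hE₀ : IsFiniteLocallyFree E₀), IsISemiregular hE₀ Set.univ → (∀ k, w k s₀ = C.ch (fiberOver π s₀) E₀ k) → ∀ (s : ComplexPoints S) (k : ℕ), w k s ∈ algebraicClasses (fiberOver π s) k))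
    {𝒳 S : SchemeOver ℂ} (f : 𝒳 ⟶ S) (hf : IsSmoothProjectiveFamily f 10)
    (hirr : IrreducibleSpace S.left) (hS : AlgebraicGeometry.Smooth S.hom) (hSqp : IsQuasiProjectiveOver S)
    (σ : ComplexPoints S → FiberClass f (2 * 5)) (hσ : Continuous σ) (hpt : ∀ s, (σ s).pt = s)
    (hrat : ∀ s, IsRationalClass (σ s).cls)
    (hH : ∀ s, IsOfHodgeType 10 (fiberOver f (σ s).pt) (2 * 5) 5 5 (σ s).cls)
    (s₀ : ComplexPoints S) (C : ChernCharacterBetti) (E₀ : (fiberOver f s₀).left.Modules)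
    (hE₀ : IsFiniteLocallyFree E₀) (hsr : IsISemiregular hE₀ Set.univ) (r₀ r : ℚ)
    (h0 : C.ch (fiberOver f s₀) E₀ 0 = ((r₀ : ℚ) : ℂ) •
      (singularCohomology.one ℂ (ComplexPoints (fiberOver f s₀)) : complexBetti (fiberOver f s₀) (2 * 0)))
    (hk : ∀ k : ℕ, k ≠ 0 → k ≠ 5 → C.ch (fiberOver f s₀) E₀ k = 0)
    (h5 : C.ch (fiberOver f s₀) E₀ 5 = ((r : ℚ) : ℂ) • (σ s₀).clsAt (hpt s₀)) :
    ∀ s : ComplexPoints S, ((r : ℚ) : ℂ) • (σ s).clsAt (hpt s) ∈ algebraicClasses (fiberOver f s) 5 := by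
  intro s
  haveI := hS
  haveI := hirr
  haveI : IsReduced S.left := isReduced_of_smooth_over_field S.hom
  have hint : IsIntegral S.left := isIntegral_of_irreducibleSpace_of_isReduced _
  -- the Weil-pure family of sections `(r₀·1, 0, 0, 0, 0, r·σ, 0, …)`, packaged with its defining equations
  obtain ⟨w, hw5, hw0, hwo⟩ :
      ∃ w : (∀ (k : ℕ) (s : ComplexPoints S), complexBetti (fiberOver f s) (2 * k)),
        (∀ s, w 5 s = ((r : ℚ) : ℂ) • (σ s).clsAt (hpt s)) ∧
        (∀ s, w 0 s = ((r₀ : ℚ) : ℂ) •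
          (singularCohomology.one ℂ (ComplexPoints (fiberOver f s)) :
            complexBetti (fiberOver f s) (2 * 0))) ∧
        (∀ k, k ≠ 0 → k ≠ 5 → ∀ s, w k s = 0) :=
    ⟨fun k s =>
      if h5 : k = 5 then h5 ▸ (((r : ℚ) : ℂ) • (σ s).clsAt (hpt s))
      else if h0 : k = 0 then
        h0 ▸ (((r₀ : ℚ) : ℂ) •
          (singularCohomology.one ℂ (ComplexPoints (fiberOver f s)) :
            complexBetti (fiberOver f s) (2 * 0)))
      else 0,
    fun s => by
      beta_reduce
      rw [dif_pos rfl],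
    fun s => by
      beta_reduce
      rw [dif_neg (by decide), dif_pos rfl],
    fun k hk0 hk5 s => by
      beta_reduce
      rw [dif_neg hk5, dif_neg hk0]⟩
  -- continuity
  have hwc : ∀ k, Continuous fun s => (⟨s, w k s⟩ : FiberClass f (2 * k)) := by
    intro k
    by_cases h5k : k = 5
    · subst h5k
      have : (fun s => (⟨s, w 5 s⟩ : FiberClass f (2 * 5))) =
          fun s => (⟨s, ((r : ℚ) : ℂ) • (σ s).clsAt (hpt s)⟩ : FiberClass f (2 * 5)) := by
        funext s; rw [hw5 s]
      rw [this]
      exact tapf_sectionSmul f (2 * 5) _ σ hpt hσ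
    by_cases h0k : k = 0
    · subst h0k
      have : (fun s => (⟨s, w 0 s⟩ : FiberClass f (2 * 0))) =
          globalSection f (2 * 0) (((r₀ : ℚ) : ℂ) •
            (singularCohomology.one ℂ (ComplexPoints 𝒳) : complexBetti 𝒳 (2 * 0))) := by
        funext s
        rw [hw0 s]
        show (⟨s, _⟩ : FiberClass f (2 * 0)) = ⟨s, _⟩
        congr 1
        rw [map_smul]
        congr 1
        exact (singularCohomology.map_one (Motives.AlgPoints.mapContinuous (L := ℂ) (fiberι f s))).symm
      rw [this]
      exact continuous_globalSection f (2 * 0) _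
    · have : (fun s => (⟨s, w k s⟩ : FiberClass f (2 * k))) = globalSection f (2 * k) 0 := by
        funext s
        rw [hwo k h0k h5k s]
        show (⟨s, _⟩ : FiberClass f (2 * k)) = ⟨s, _⟩
        rw [map_zero]
      rw [this]
      exact continuous_globalSection f (2 * k) _
  -- values in the locus of Hodge classes
  have hwH : ∀ k s, (⟨s, w k s⟩ : FiberClass f (2 * k)) ∈ locusOfHodgeClasses f 10 k := by
    intro k s
    rw [mem_locusOfHodgeClasses_iff]
    by_cases h5k : k = 5
    · subst h5k
      obtain ⟨hr', hh'⟩ := tapf_clsAt_rational_hodge (σ s) s (hpt s) (hrat s) (hH s)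
      refine ⟨?_, ?_⟩
      · rw [hw5 s]
        exact hr'.smul r
      · rw [hw5 s]
        exact hh'.smul _
    by_cases h0k : k = 0
    · subst h0k
      refine ⟨?_, ?_⟩
      · rw [hw0 s]
        exact (isRationalClass_one _).smul r₀
      · exact isOfHodgeType_zero_zero_of_degree_zero (hf.isSmoothProjective s) _
    · obtain ⟨M⟩ := (nonempty_hodgeModel_holds (n := 10) (X := fiberOver f s)).nonempty
        (hf.isSmoothProjective s)
      rw [hwo k h0k h5k s]
      exact ⟨IsRationalClass.zero, IsOfHodgeType.zero M _ _ _⟩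
  -- the values at `s₀` are the Chern character of `E₀`
  have hw₀ : ∀ k, w k s₀ = C.ch (fiberOver f s₀) E₀ k := by
    intro k
    by_cases h5k : k = 5
    · subst h5k
      rw [hw5 s₀, h5]
    by_cases h0k : k = 0
    · subst h0k
      rw [hw0 s₀, h0]
    · rw [hwo k h0k h5k s₀, hk k h0k h5k]
  -- Perry
  have h := hP C f 10 hf hSqp hint hS w hwc hwH s₀ E₀ hE₀ hsr hw₀ s 5
  rwa [hw5 s] at h

/-! ## The composition: the four open stubs of the line imply the crux, BY NAME -/

/-- **Stub `stub_perryRouteCompositionFull` (registered on stmt-HodgeConjecture-1262): `WeilTenfoldsSqrtMinus11`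
from the four open stubs of skeleton v2.1** — Deligne's Weil family (named fact), Perry's theorem with FULL
semiregularity (spelled out; = `Perry2026_semiregularFull_remainsAlgebraic` of p129195), a standard Chern
character on the real carriers, and THE BET in full-semiregularity form. Proof verbatim that of the landed
`TensorAnchorPerry.stub_perryRouteComposition`: `c = 0` is algebraic; otherwise upgrade `c` to the strong plane
(`stub_upgrade`), take Deligne's family through `A ≅ 𝒳_{s₁}` with its continuous fibrewise-Hodge section `σ`
through `c` and its tensor-isogenous fibre `Y ≅ 𝒳_{s₀}`; `σ` is rational everywhere
(`stub_rationalAlongSection`) and `σ(s₀) = x ≠ 0` (`gcs_section_eq_of_eq`); the bet gives the Weil-pure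
semiregular `E₀` on `𝒳_{s₀}` with `ch₅(E₀) = r·x`; `sectionTransport_of_perryFull` makes `r·σ(s₁) = r·e^{-1*}c`
algebraic; divide by `r ≠ 0` and pull back along `e` (`IsoInvariance`). CONDITIONAL on exactly its four
hypotheses. [cite: Deligne1982HodgeCycles, proof of Thm. 4.8 (pp. 47–52) with Prop. 4.4, Lemma 4.5, Remark 4.10]
[cite: Perry2026Semiregularity, Thm. 1.1 (2), Def. 2.4, Rem. 2.5] [cite: BuchweitzFlenner2003, Def. 4.1 and Thm. 5.1]
[cite: Markman2025SecantWeil, §1.2 and Thm. 1.5.1] -/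
theorem stub_perryRouteCompositionFull : deligne1982_weilFamily_hodgeWeilSection → (∀ (C : ChernCharacterBetti) ⦃𝒳 S : SchemeOver ℂ⦄ (π : 𝒳 ⟶ S) (n : ℕ), IsSmoothProjectiveFamily π n → IsQuasiProjectiveOver S → AlgebraicGeometry.IsIntegral S.left → AlgebraicGeometry.Smooth S.hom → ∀ (w : ∀ (k : ℕ) (s : ComplexPoints S), complexBetti (fiberOver π s) (2 * k)), (∀ k, Continuous fun s => (⟨s, w k s⟩ : FiberClass π (2 * k))) → (∀ k s, (⟨s, w k s⟩ : FiberClass π (2 * k)) ∈ locusOfHodgeClasses π n k) → ∀ (s₀ : ComplexPoints S) (E₀ : (fiberOver π s₀).left.Modules) (hE₀ : IsFiniteLocallyFree E₀), IsISemiregular hE₀ Set.univ → (∀ k, w k s₀ = C.ch (fiberOver π s₀) E₀ k) → ∀ (s : ComplexPoints S) (k : ℕ), w k s ∈ algebraicClasses (fiberOver π s) k) → Nonempty StandardChernCharacterBetti → (∀ (C : StandardChernCharacterBetti) (Y : AbelianVariety ℂ) (Ψ : Y ⟶ Y) (A₁ : AbelianVariety ℂ) (f₁ : Y ⟶ A₁.prod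 A₁) (g₁ : A₁.prod A₁ ⟶ Y) (m : ℕ), A₁.dim = 5 → Y.dim = 10 → Ψ ≫ Ψ = -((11 : ℤ) • 𝟙 Y) → 0 < m → f₁ ≫ g₁ = m • 𝟙 Y → AlgebraicGeometry.Flat f₁.hom.hom.hom.left → g₁ ≫ Ψ = AbelianVariety.prodLift (AbelianVariety.snd A₁ A₁ ≫ (-((11 : ℤ) • 𝟙 A₁))) (AbelianVariety.fst A₁ A₁) ≫ g₁ → ∀ (F₀ : SchemeOver ℂ) (e₀ : Y.X ≅ F₀) (x₀ : complexBetti F₀ (2 * 5)), IsRationalClass x₀ → IsOfHodgeType 10 F₀ (2 * 5) 5 5 x₀ → complexBetti.map e₀.hom (2 * 5) x₀ ∈ weilClassesOf Y Ψ 5 11 → x₀ ≠ 0 → ∃ (E₀ : F₀.left.Modules) (hE₀ : IsFiniteLocallyFree E₀), IsISemiregular hE₀ Set.univ ∧ ∃ (r₀ r : ℚ), r ≠ 0 ∧ C.ch F₀ E₀ 0 = ((r₀ : ℚ) : ℂ) • (singularCohomology.one ℂ (ComplexPoints F₀) : complexBetti F₀ (2 * 0)) ∧ (∀ k : ℕ,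 k ≠ 0 → k ≠ 5 → C.ch F₀ E₀ k = 0) ∧ C.ch F₀ E₀ 5 = ((r : ℚ) : ℂ) • x₀) → Summit.HodgeConjecture.HodgeConjecture.Theses.HeckePrymWeil.WeilTenfoldsSqrtMinus11 := by
  intro hWF hP hC hB A φ hA hφ c hr hH hW
  by_cases hc : c = 0
  · rw [hc]
    exact Submodule.zero_mem _
  -- casts: the named fact is stated for a variable prime `p`, here `p = 11`, at degree `2 * 5`
  have hφ' : φ ≫ φ = -(((11 : ℕ) : ℤ) • 𝟙 A) := by exact_mod_cast hφ
  have hA' : A.dim = 2 * 5 := hA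
  -- typing upgrade (proved): the single-operator plane lies in the strong Weil plane
  have hcW : c ∈ weilClassesOf A φ 5 11 := by
    refine stub_upgrade 11 (by norm_num) (by norm_num) (by norm_num) 5 A φ hA' hφ' ?_
    exact_mod_cast hW
  -- hypothesis 1: Deligne's Weil family through `A`, section through `c`, tensor-isogenous fibre
  obtain ⟨𝒳, S, f, s₁, s₀, e, σ, hfam, -, hirr, hsmooth, hSqp, -, hσ, hpt, hHσ, hs₁, Y, Ψ, e₀, x,
    ⟨A₁, f₁, g₁, m, hA₁, hY, hΨ, hm, hfg, hf₁, hg₁⟩, hs₀, hx⟩ :=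
    hWF 11 (by norm_num) (by norm_num) (by norm_num) 5 (by norm_num) A φ hA' hφ' c hcW hc hr hH
  -- rationality along the section (proved)
  have hrat₁ : IsRationalClass (σ s₁).cls := by
    rw [hs₁]; exact hr.map _
  have hratσ : ∀ s, IsRationalClass (σ s).cls :=
    stub_rationalAlongSection f (2 * 5) (2 * 5) hfam hsmooth hSqp hirr σ hσ hpt s₁ hrat₁
  have hratx : IsRationalClass x := by
    have h := hratσ s₀
    rwa [hs₀] at h
  have hHx : IsOfHodgeType 10 (fiberOver f s₀) (2 * 5) 5 5 x := by
    have h := hHσ s₀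
    rw [hs₀] at h
    exact h
  -- `x ≠ 0`: a continuous section vanishing at `s₀` vanishes identically (identity principle, proved)
  have hx0 : x ≠ 0 := by
    intro hx0
    haveI := hsmooth
    haveI := hirr
    haveI : LocallyOfFiniteType S.hom := hSqp.locallyOfFiniteType
    haveI : ConnectedSpace (ComplexPoints S) :=
      (ComplexPoints.connectedSpace_iff_holds S).2 inferInstance
    obtain ⟨d, hd⟩ := exists_smoothOfRelativeDimension_of_connectedSpace_complexPoints S
    haveI := hd
    haveI := pathConnectedSpace_complexPoints_of_smoothOfRelativeDimension S d
    have hU := isCohomologicallyLocallyTrivialOn_univ_of_isSmoothProjectiveFamily f d hfam hSqp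
    have hzero : σ s₀ = globalSection f (2 * 5) 0 s₀ := by
      rw [hs₀, hx0]
      show (⟨s₀, 0⟩ : FiberClass f (2 * 5)) = ⟨s₀, _⟩
      rw [map_zero]
    have hall := gcs_section_eq_of_eq f (2 * 5) hU hσ hpt (continuous_globalSection f _ 0)
      (fun _ => rfl) hzero s₁
    rw [hs₁] at hall
    have hc' : complexBetti.map e.inv (2 * 5) c = 0 := by
      have h2 := ((FiberClass.clsAt_eq_iff _ rfl _).2 hall.symm).symm
      -- `h2 : e.inv^* c = (globalSection f 10 0 s₁).clsAt rfl`
      rw [h2]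
      show complexBetti.map (fiberι f s₁) (2 * 5) 0 = 0
      rw [map_zero]
    apply hc
    have h3 := congrArg (complexBetti.map e.hom (2 * 5)) hc'
    rwa [map_zero, ← CategoryTheory.comp_apply, ← complexBetti.map_comp, Iso.hom_inv_id,
      complexBetti.map_id, CategoryTheory.id_apply] at h3
  -- hypothesis 3: a standard Chern character
  obtain ⟨C⟩ := hC
  -- hypothesis 4 (the bet): the Weil-pure semiregular object on the fibre `X_{s₀} ≅ Y`
  obtain ⟨E₀, hE₀, hsr, r₀, r, hr0, h0, hk, h5⟩ :=
    hB C Y Ψ A₁ f₁ g₁ m hA₁ hY (by exact_mod_cast hΨ) hm hfg hf₁ (by exact_mod_cast hg₁)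
      (fiberOver f s₀) e₀ x hratx hHx hx hx0
  have h5' : C.ch (fiberOver f s₀) E₀ 5 = ((r : ℚ) : ℂ) • (σ s₀).clsAt (hpt s₀) := by
    rw [h5, (FiberClass.clsAt_eq_iff _ _ _).2 hs₀]
  -- hypothesis 2 through the engine step: `r·σ` is algebraic everywhere, in particular over `s₁`
  have halg := sectionTransport_of_perryFull hP f hfam hirr hsmooth hSqp σ hσ hpt hratσ hHσ s₀
    C.toChernCharacterBetti E₀ hE₀ hsr r₀ r h0 hk h5' s₁
  rw [(FiberClass.clsAt_eq_iff _ _ _).2 hs₁] at halg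
  have hrC : ((r : ℚ) : ℂ) ≠ 0 := by exact_mod_cast hr0
  have h1 : complexBetti.map e.inv (2 * 5) c ∈ algebraicClasses (fiberOver f s₁) 5 :=
    (Submodule.smul_mem_iff _ hrC).mp halg
  -- back along `e : A ≅ 𝒳_{s₁}` (the route's proved `IsoInvariance`)
  have key := Theorems.isoInvariance_proof e 5 _ h1
  rw [← CategoryTheory.comp_apply, ← complexBetti.map_comp, Iso.hom_inv_id,
    complexBetti.map_id] at key
  exact key

end Summit.HodgeConjecture.HodgeConjecture.Theorems.WeilTenfoldsSqrtMinus11.TensorAnchorPerryFull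

end
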